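import Mathlib
import Summits.KontsevichZagierPeriods.Zeta5Search.CellKitLevel
import HarnessLib

/-!
# ζ(5) search — CELL KIT, part 2: digits, pair vectors and block sums of the level-`m` classes (generic LB♯♯, blocks)

Cell `pub-zeta5` (HONEST FRAMING: systematic search; no irrationality claim unless certified), P1 prover seat generation 7.
The assembly behind P1 g5/g6's record cells A, C, D, E, F made GENERIC in the vector `b` (any point of the polytope with
`b + e_j` in the polytope), the direction `j`, the window prime `p` and the level `m ≤ −4`:
let every residue class have class exponent `E_x ≥ m` and let the LEVEL-`m` CLASSES (`E_x = m`) avoid the centre.  With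
`x̄ = conjClass b p x`, `ε = (−1)^{m+1}` and the PAIR VECTOR `(α_x, β_x) = (ŵ_x + ε ŵ_x̄, v̂_x + ε v̂_x̄)` (written out; no new definitions):
* **origin** (`origin_bound`): if the pair vectors of the level-`m` classes are collinear through the origin
  (`α_x β_y = α_y β_x`), then `v_p(Cas_j(b)) ≥ (3 + 2m) + 1`;
* **zero** (`zero_bound`, `zero_bound_WV`): if they all vanish, `v_p(Cas_j(b)) ≥ (3 + 2m) + 2`, `v_p(W(b)) ≥ m + 4`, `v_p(V(b)) ≥ m + 1`.
(`3 + 2m` is THEOREM LB's `casLB` on such cells.)  Mechanism (P1 g6): per class the normalised digits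
`(−p)^{−(m+3)}W_x ≡ ĝ_x ŵ_x`, `(−p)^{−m}V_x ≡ ĝ_x v̂_x`, `ĝ_x̄ ≡ ε ĝ_x` (`LevelClassDigits`), so twice the level-`m` block is
`Σ ĝ_x α_x` resp. `Σ ĝ_x β_x`; the other classes are `O(p)` smaller; for `b + e_j` the level-`m` classes are the unhit ones of `b` with the
same pair vectors (`CellKitLevel`), and `Σ_{x,y} ĝ⁺_x ĝ_y (α_x β_y − α_y β_x) = 0`.  Valuations of rationals; nothing about irrationality.
-/

noncomputable section

open Finset

namespace Summit.KontsevichZagierPeriods.Zeta5Search.CellKit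

open Summit.KontsevichZagierPeriods.Zeta5Search.DualSeries (InBox)
open Summit.KontsevichZagierPeriods.Zeta5Search.WedgeDictionary (coeffW coeffV)
open Summit.KontsevichZagierPeriods.Zeta5Search.CasoratianValuation (InPolytope shift casoratian)
open Summit.KontsevichZagierPeriods.Zeta5Search.ClusterValuation (netExp classSet CentreIn classExp classV gHat conjClass
  classSet_shift centreIn_shift classExp_shift_ge le_of_mem_classSet conjClass_lt conjClass_conjClass classExp_conj
  centreIn_conj_iff coeffV_eq_sum_classV val_ge_of_padicNorm_le thmA_data)
open Summit.KontsevichZagierPeriods.Zeta5Search.PadicSeries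
open Summit.KontsevichZagierPeriods.Zeta5Search.BigPrime (shift_zero padicNorm_mul_le_one)
open Summit.KontsevichZagierPeriods.Zeta5Search.CellA (classW wHat vHat coeffW_eq_sum_classW classExp_le_classNu padicNorm_zpow_unit)
open Summit.KontsevichZagierPeriods.Zeta5Search.CellD (padicNorm_classW_le padicNorm_classV_le_of small_of_two_mul)
open Summit.KontsevichZagierPeriods.Zeta5Search.CellC (small_mul_small)
open Summit.KontsevichZagierPeriods.Zeta5Search.LevelClass


/-! No new definitions: the level-`m` set is `(Finset.range p).filter (fun x => classExp b p x = m)`, the pair vector is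
`(ŵ_x + (−1)^{m+1} ŵ_x̄, v̂_x + (−1)^{m+1} v̂_x̄)` written out, the normalised pieces are `(−p)^{−(m+3)} W_x`, `(−p)^{−m} V_x`. -/

variable {p : ℕ} [hp : Fact p.Prime]

/-! ### §1 Data: the level-`m` classes and the pair vectors -/

omit hp in
/-- Membership in the level-`m` set. -/
theorem mem_minSet {b : ℕ → ℤ} {m : ℤ} {x : ℕ} : x ∈ (Finset.filter (fun x => classExp b p x = m) (Finset.range p)) ↔ x < p ∧ classExp b p x = m := by
  simp

/-- The level data of a residue `x < p ≤ b₀`: `L = (b₀ − x)/p`. -/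
theorem level_of_lt (b : ℕ → ℤ) {x : ℕ} (hx : x < p) (hpN : p ≤ (b 0).toNat) :
    x + (((b 0).toNat - x) / p) * p ≤ (b 0).toNat ∧ (b 0).toNat < x + (((b 0).toNat - x) / p) * p + p := by
  have h := Nat.div_add_mod ((b 0).toNat - x) p
  have h2 := Nat.mod_lt ((b 0).toNat - x) hp.out.pos
  have hx' : x ≤ (b 0).toNat := by omega
  rw [Nat.mul_comm] at h
  constructor <;> omega

/-! ### §2 The digits of one level-`m` class -/

/-- **The digits of a level-`m` class** (`E_x = m ≤ −1`, centre-free): `‖(−p)^{−(m+3)}W_x − ĝ_x ŵ_x‖ ≤ p⁻¹`,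
`‖(−p)^{−m}V_x − ĝ_x v̂_x‖ ≤ p⁻¹`, `‖ĝ_x̄ − (−1)^{m+1}ĝ_x‖ ≤ p⁻¹`, and `ĝ_x, ŵ_x, v̂_x` are `p`-integral. -/
theorem class_digits (b : ℕ → ℤ) (hb : InPolytope b) (hp5 : 5 ≤ p) (hwin : (b 0 + 2 : ℤ) < (p : ℤ) ^ 2)
    (hpN : p ≤ (b 0).toNat) {m : ℤ} (hm : m ≤ -1) {x : ℕ} (hx : x < p) (hE : classExp b p x = m) (hc : ¬ CentreIn b p x) :
    padicNorm p ((-(p : ℚ)) ^ (-(m + 3)) * classW b p x - gHat b p x * wHat b p x) ≤ (p : ℚ) ^ (-(1 : ℤ)) ∧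
    padicNorm p ((-(p : ℚ)) ^ (-m) * classV b p x - gHat b p x * vHat b p x) ≤ (p : ℚ) ^ (-(1 : ℤ)) ∧
    padicNorm p (gHat b p (conjClass b p x) - (-1 : ℚ) ^ (m + 1) * gHat b p x) ≤ (p : ℚ) ^ (-(1 : ℤ)) ∧
    padicNorm p (gHat b p x) ≤ 1 ∧ padicNorm p (wHat b p x) ≤ 1 ∧ padicNorm p (vHat b p x) ≤ 1 := by
  obtain ⟨hL, hL'⟩ := level_of_lt b hx hpN
  set L := ((b 0).toNat - x) / p with hLdef
  set e : ℕ → ℤ := fun k => netExp b (x + k * p) with hedef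
  have he : ∀ k ≤ L, netExp b (x + k * p) = e k := fun k _ => rfl
  have hEt : classExp b p x = typeExp L e := classExp_level b hx hL hL' e he hc
  have hneg : classExp b p x < 0 := by omega
  obtain ⟨i₀, hi₀, hi₀neg⟩ := exists_pole_level b hx hL hL' hc hneg
  have hg0 : padicNorm p (gHat b p x - gHat b p x) ≤ (p : ℚ) ^ (-(1 : ℤ)) := by
    rw [sub_self, padicNorm.zero]; exact zpow_p_nonneg _
  have hw := w_digit_level b hx hL hL' hb hp5 hwin e he hc hi₀ hi₀neg hg0
  have hv := v_digit_level b hx hL hL' hb hp5 hwin e he hc hi₀ hi₀neg hg0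
  have hgc := gHat_conj_level b hx hL hL' hb hp5 e he hc
  rw [← hEt, hE, ← wHat_level b hx hL hL' e he hc] at hw
  rw [← hEt, hE, ← vHat_level b hx hL hL' e he hc] at hv
  rw [← hEt, hE, ← conjClass_eq_level b hL hL'] at hgc
  obtain ⟨hbox, -, -, hn⟩ := thmA_data b hb hwin
  have hp2 : p ≠ 2 := by have := hp.out.two_le; omega
  have hx0 : x ∈ classSet b p x := by simpa using level_mem b hx hL hL' (Nat.zero_le L)
  exact ⟨hw, hv, hgc, padicNorm_gHat_le_one b hb hp5 hx hx0, padicNorm_wHat_le_one b hbox.1 hn hp2 x,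
    padicNorm_vHat_le_one b hbox.1 hn hp2⟩

/-! ### §3 The block sums of one vector `b` -/

section Block

variable (b : ℕ → ℤ) (hb : InPolytope b) (hp5 : 5 ≤ p) (hwin : (b 0 + 2 : ℤ) < (p : ℤ) ^ 2) (hpN : p ≤ (b 0).toNat)
  {m : ℤ} (hm : m ≤ -4) (hmin : ∀ x, x < p → m ≤ classExp b p x)
  (hcen : ∀ x, x < p → classExp b p x = m → ¬ CentreIn b p x)

include hpN in
/-- Conjugation preserves the level-`m` set. -/
theorem conj_mem_minSet (h0 : 0 ≤ b 0) {x : ℕ} (hx : x ∈ (Finset.filter (fun x => classExp b p x = m) (Finset.range p))) : conjClass b p x ∈ (Finset.filter (fun x => classExp b p x = m) (Finset.range p)) := by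
  rw [mem_minSet] at hx ⊢
  exact ⟨conjClass_lt b hp.out.pos x, by rw [classExp_conj b h0 (by omega)]; exact hx.2⟩

include hpN in
/-- A sum over the level-`m` set equals the sum of the conjugates. -/
theorem sum_minSet_conj (h0 : 0 ≤ b 0) (f : ℕ → ℚ) :
    ∑ x ∈ (Finset.filter (fun x => classExp b p x = m) (Finset.range p)), f (conjClass b p x) = ∑ x ∈ (Finset.filter (fun x => classExp b p x = m) (Finset.range p)), f x :=
  sum_nbij' (fun x => conjClass b p x) (fun x => conjClass b p x) (fun _ hx => conj_mem_minSet b hpN h0 hx)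
    (fun _ hx => conj_mem_minSet b hpN h0 hx) (fun _ hx => conjClass_conjClass b (mem_minSet.1 hx).1 hpN)
    (fun _ hx => conjClass_conjClass b (mem_minSet.1 hx).1 hpN) (fun _ _ => rfl)

include hb hp5 hwin hpN hm hcen in
/-- **A conjugate pair of level-`m` classes in terms of the pair vector**:
`‖X_x + X_x̄ − ĝ_x α_x‖ ≤ p⁻¹` for `W`, the same for `V`, and `X_x`, `ĝ_x α_x`, `ĝ_x β_x` are integral. -/
theorem pair_digits {x : ℕ} (hx : x ∈ (Finset.filter (fun x => classExp b p x = m) (Finset.range p))) :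
    padicNorm p (((-(p : ℚ)) ^ (-(m + 3)) * classW b p x) + ((-(p : ℚ)) ^ (-(m + 3)) * classW b p (conjClass b p x)) - gHat b p x * (wHat b p x + (-1 : ℚ) ^ (m + 1) * wHat b p (conjClass b p x))) ≤ (p : ℚ) ^ (-(1 : ℤ)) ∧
    padicNorm p (((-(p : ℚ)) ^ (-m) * classV b p x) + ((-(p : ℚ)) ^ (-m) * classV b p (conjClass b p x)) - gHat b p x * (vHat b p x + (-1 : ℚ) ^ (m + 1) * vHat b p (conjClass b p x))) ≤ (p : ℚ) ^ (-(1 : ℤ)) ∧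
    padicNorm p (((-(p : ℚ)) ^ (-(m + 3)) * classW b p x)) ≤ 1 ∧ padicNorm p (((-(p : ℚ)) ^ (-m) * classV b p x)) ≤ 1 ∧
    padicNorm p (gHat b p x * (wHat b p x + (-1 : ℚ) ^ (m + 1) * wHat b p (conjClass b p x))) ≤ 1 ∧ padicNorm p (gHat b p x * (vHat b p x + (-1 : ℚ) ^ (m + 1) * vHat b p (conjClass b p x))) ≤ 1 := by
  have h0 : 0 ≤ b 0 := hb.1.1
  obtain ⟨hxp, hE⟩ := mem_minSet.1 hx
  have hx' := conj_mem_minSet b hpN h0 hx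
  obtain ⟨hxp', hE'⟩ := mem_minSet.1 hx'
  obtain ⟨w1, v1, g1, ig, iw, iv⟩ := class_digits b hb hp5 hwin hpN (by omega) hxp hE (hcen x hxp hE)
  obtain ⟨w2, v2, -, ig', iw', iv'⟩ := class_digits b hb hp5 hwin hpN (by omega) hxp' hE' (hcen _ hxp' hE')
  have ieps : padicNorm p ((-1 : ℚ) ^ (m + 1)) ≤ 1 := by
    rw [padicNorm_zpow_unit (by rw [padicNorm.neg, padicNorm.one])]
  refine ⟨?_, ?_, ?_, ?_, padicNorm_mul_le_one ig (CellA.nI_add iw (padicNorm_mul_le_one ieps iw')), padicNorm_mul_le_one ig (CellA.nI_add iv (padicNorm_mul_le_one ieps iv'))⟩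
  · have e : ((-(p : ℚ)) ^ (-(m + 3)) * classW b p x) + ((-(p : ℚ)) ^ (-(m + 3)) * classW b p (conjClass b p x)) - gHat b p x * (wHat b p x + (-1 : ℚ) ^ (m + 1) * wHat b p (conjClass b p x)) =
        ((-(p : ℚ)) ^ (-(m + 3)) * classW b p x - gHat b p x * wHat b p x) +
        ((-(p : ℚ)) ^ (-(m + 3)) * classW b p (conjClass b p x) - gHat b p (conjClass b p x) * wHat b p (conjClass b p x)) +
        wHat b p (conjClass b p x) * (gHat b p (conjClass b p x) - (-1 : ℚ) ^ (m + 1) * gHat b p x) := by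
      ring
    rw [e]; exact CellA.small_add (CellA.small_add w1 w2) (CellA.small_mul iw' g1)
  · have e : ((-(p : ℚ)) ^ (-m) * classV b p x) + ((-(p : ℚ)) ^ (-m) * classV b p (conjClass b p x)) - gHat b p x * (vHat b p x + (-1 : ℚ) ^ (m + 1) * vHat b p (conjClass b p x)) =
        ((-(p : ℚ)) ^ (-m) * classV b p x - gHat b p x * vHat b p x) +
        ((-(p : ℚ)) ^ (-m) * classV b p (conjClass b p x) - gHat b p (conjClass b p x) * vHat b p (conjClass b p x)) +
        vHat b p (conjClass b p x) * (gHat b p (conjClass b p x) - (-1 : ℚ) ^ (m + 1) * gHat b p x) := by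
      ring
    rw [e]; exact CellA.small_add (CellA.small_add v1 v2) (CellA.small_mul iv' g1)
  · have e : ((-(p : ℚ)) ^ (-(m + 3)) * classW b p x) = ((-(p : ℚ)) ^ (-(m + 3)) * classW b p x - gHat b p x * wHat b p x) + gHat b p x * wHat b p x := by
      ring
    rw [e]; exact CellA.nI_add (CellA.nI_of_small w1) (padicNorm_mul_le_one ig iw)
  · have e : ((-(p : ℚ)) ^ (-m) * classV b p x) = ((-(p : ℚ)) ^ (-m) * classV b p x - gHat b p x * vHat b p x) + gHat b p x * vHat b p x := by
      ring
    rw [e]; exact CellA.nI_add (CellA.nI_of_small v1) (padicNorm_mul_le_one ig iv)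

include hb hp5 hwin hpN hm hcen in
/-- **The level-`m` block**: `A = Σ_{E_x = m} X_x` is integral and `‖2A − Σ ĝ_x α_x‖ ≤ p⁻¹`; the same for `V`; the `ĝ`-sums are integral. -/
theorem block_digits :
    padicNorm p (∑ x ∈ (Finset.filter (fun x => classExp b p x = m) (Finset.range p)), ((-(p : ℚ)) ^ (-(m + 3)) * classW b p x)) ≤ 1 ∧ padicNorm p (∑ x ∈ (Finset.filter (fun x => classExp b p x = m) (Finset.range p)), ((-(p : ℚ)) ^ (-m) * classV b p x)) ≤ 1 ∧
    padicNorm p (2 * ∑ x ∈ (Finset.filter (fun x => classExp b p x = m) (Finset.range p)), ((-(p : ℚ)) ^ (-(m + 3)) * classW b p x) - ∑ x ∈ (Finset.filter (fun x => classExp b p x = m) (Finset.range p)), gHat b p x * (wHat b p x + (-1 : ℚ) ^ (m + 1) * wHat b p (conjClass b p x))) ≤ (p : ℚ) ^ (-(1 : ℤ)) ∧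
    padicNorm p (2 * ∑ x ∈ (Finset.filter (fun x => classExp b p x = m) (Finset.range p)), ((-(p : ℚ)) ^ (-m) * classV b p x) - ∑ x ∈ (Finset.filter (fun x => classExp b p x = m) (Finset.range p)), gHat b p x * (vHat b p x + (-1 : ℚ) ^ (m + 1) * vHat b p (conjClass b p x))) ≤ (p : ℚ) ^ (-(1 : ℤ)) ∧
    padicNorm p (∑ x ∈ (Finset.filter (fun x => classExp b p x = m) (Finset.range p)), gHat b p x * (wHat b p x + (-1 : ℚ) ^ (m + 1) * wHat b p (conjClass b p x))) ≤ 1 ∧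
    padicNorm p (∑ x ∈ (Finset.filter (fun x => classExp b p x = m) (Finset.range p)), gHat b p x * (vHat b p x + (-1 : ℚ) ^ (m + 1) * vHat b p (conjClass b p x))) ≤ 1 := by
  have h0 : 0 ≤ b 0 := hb.1.1
  have PD := fun x (hx : x ∈ (Finset.filter (fun x => classExp b p x = m) (Finset.range p))) => pair_digits b hb hp5 hwin hpN hm hcen hx
  refine ⟨padicNorm.sum_le' (fun x hx => (PD x hx).2.2.1) zero_le_one,
    padicNorm.sum_le' (fun x hx => (PD x hx).2.2.2.1) zero_le_one, ?_, ?_,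
    padicNorm.sum_le' (fun x hx => (PD x hx).2.2.2.2.1) zero_le_one,
    padicNorm.sum_le' (fun x hx => (PD x hx).2.2.2.2.2) zero_le_one⟩
  · have e : 2 * ∑ x ∈ (Finset.filter (fun x => classExp b p x = m) (Finset.range p)), ((-(p : ℚ)) ^ (-(m + 3)) * classW b p x) - ∑ x ∈ (Finset.filter (fun x => classExp b p x = m) (Finset.range p)), gHat b p x * (wHat b p x + (-1 : ℚ) ^ (m + 1) * wHat b p (conjClass b p x)) =
        ∑ x ∈ (Finset.filter (fun x => classExp b p x = m) (Finset.range p)), (((-(p : ℚ)) ^ (-(m + 3)) * classW b p x) + ((-(p : ℚ)) ^ (-(m + 3)) * classW b p (conjClass b p x)) - gHat b p x * (wHat b p x + (-1 : ℚ) ^ (m + 1) * wHat b p (conjClass b p x))) := by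
      rw [sum_sub_distrib, sum_add_distrib, sum_minSet_conj b hpN h0 (fun x => ((-(p : ℚ)) ^ (-(m + 3)) * classW b p x))]; ring
    rw [e]; exact padicNorm.sum_le' (fun x hx => (PD x hx).1) (zpow_p_nonneg _)
  · have e : 2 * ∑ x ∈ (Finset.filter (fun x => classExp b p x = m) (Finset.range p)), ((-(p : ℚ)) ^ (-m) * classV b p x) - ∑ x ∈ (Finset.filter (fun x => classExp b p x = m) (Finset.range p)), gHat b p x * (vHat b p x + (-1 : ℚ) ^ (m + 1) * vHat b p (conjClass b p x)) =
        ∑ x ∈ (Finset.filter (fun x => classExp b p x = m) (Finset.range p)), (((-(p : ℚ)) ^ (-m) * classV b p x) + ((-(p : ℚ)) ^ (-m) * classV b p (conjClass b p x)) - gHat b p x * (vHat b p x + (-1 : ℚ) ^ (m + 1) * vHat b p (conjClass b p x))) := by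
      rw [sum_sub_distrib, sum_add_distrib, sum_minSet_conj b hpN h0 (fun x => ((-(p : ℚ)) ^ (-m) * classV b p x))]; ring
    rw [e]; exact padicNorm.sum_le' (fun x hx => (PD x hx).2.1) (zpow_p_nonneg _)

include hb hp5 hwin hm hmin in
/-- **The other classes are `O(p)` smaller**: for `x < p` with `E_x ≠ m` (hence `≥ m+1`), `‖X^W_x‖, ‖X^V_x‖ ≤ p⁻¹`. -/
theorem rest_small {x : ℕ} (hx : x < p) (hxm : x ∉ (Finset.filter (fun x => classExp b p x = m) (Finset.range p))) :
    padicNorm p (((-(p : ℚ)) ^ (-(m + 3)) * classW b p x)) ≤ (p : ℚ) ^ (-(1 : ℤ)) ∧ padicNorm p (((-(p : ℚ)) ^ (-m) * classV b p x)) ≤ (p : ℚ) ^ (-(1 : ℤ)) := by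
  have hE : m + 1 ≤ classExp b p x := by
    have h1 := hmin x hx
    have h2 : classExp b p x ≠ m := fun h => hxm (mem_minSet.2 ⟨hx, h⟩)
    omega
  have hp0 : (p : ℚ) ≠ 0 := Nat.cast_ne_zero.2 hp.out.ne_zero
  have hW := padicNorm_classW_le (m := m + 1) b hb hp5 hwin (by omega) (fun _ => hE)
  have hV := padicNorm_classV_le_of (v := m + 1) b hb hp5 hwin hx (fun _ => hE.trans (classExp_le_classNu _ _ _))
  refine ⟨?_, ?_⟩
  · rw [padicNorm.mul, padicNorm_neg_p_zpow, neg_neg]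
    calc (p : ℚ) ^ (m + 3) * padicNorm p (classW b p x) ≤ (p : ℚ) ^ (m + 3) * (p : ℚ) ^ (-(m + 1 + 3)) :=
          mul_le_mul_of_nonneg_left hW (zpow_p_nonneg _)
      _ = (p : ℚ) ^ (-(1 : ℤ)) := by rw [← zpow_add₀ hp0]; ring_nf
  · rw [padicNorm.mul, padicNorm_neg_p_zpow, neg_neg]
    calc (p : ℚ) ^ m * padicNorm p (classV b p x) ≤ (p : ℚ) ^ m * (p : ℚ) ^ (-(m + 1)) :=
          mul_le_mul_of_nonneg_left hV (zpow_p_nonneg _)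
      _ = (p : ℚ) ^ (-(1 : ℤ)) := by rw [← zpow_add₀ hp0]; ring_nf

include hb hp5 hwin hm hmin in
/-- **The full sums**: `(−p)^{−(m+3)}·W(b) = A + R_W`, `(−p)^{−m}·V(b) = B + R_V` with `‖R_W‖, ‖R_V‖ ≤ p⁻¹`. -/
theorem full_split :
    padicNorm p ((-(p : ℚ)) ^ (-(m + 3)) * coeffW b - ∑ x ∈ (Finset.filter (fun x => classExp b p x = m) (Finset.range p)), ((-(p : ℚ)) ^ (-(m + 3)) * classW b p x)) ≤ (p : ℚ) ^ (-(1 : ℤ)) ∧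
    padicNorm p ((-(p : ℚ)) ^ (-m) * coeffV b - ∑ x ∈ (Finset.filter (fun x => classExp b p x = m) (Finset.range p)), ((-(p : ℚ)) ^ (-m) * classV b p x)) ≤ (p : ℚ) ^ (-(1 : ℤ)) := by
  have hMr : (Finset.filter (fun x => classExp b p x = m) (Finset.range p)) ⊆ range p := filter_subset _ _
  have split : ∀ f : ℕ → ℚ, ∑ x ∈ range p, f x - ∑ x ∈ (Finset.filter (fun x => classExp b p x = m) (Finset.range p)), f x = ∑ x ∈ range p \ (Finset.filter (fun x => classExp b p x = m) (Finset.range p)), f x := by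
    intro f
    rw [← sum_sdiff hMr]; ring
  refine ⟨?_, ?_⟩
  · rw [coeffW_eq_sum_classW b hp.out.pos, mul_sum, show (∑ i ∈ range p, (-(p : ℚ)) ^ (-(m + 3)) * classW b p i) =
      ∑ i ∈ range p, ((-(p : ℚ)) ^ (-(m + 3)) * classW b p i) from rfl, split]
    exact padicNorm.sum_le' (fun x hx => by
      rw [mem_sdiff, mem_range] at hx; exact (rest_small b hb hp5 hwin hm hmin hx.1 hx.2).1) (zpow_p_nonneg _)
  · rw [coeffV_eq_sum_classV b hp.out.pos, mul_sum, show (∑ i ∈ range p, (-(p : ℚ)) ^ (-m) * classV b p i) =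
      ∑ i ∈ range p, ((-(p : ℚ)) ^ (-m) * classV b p i) from rfl, split]
    exact padicNorm.sum_le' (fun x hx => by
      rw [mem_sdiff, mem_range] at hx; exact (rest_small b hb hp5 hwin hm hmin hx.1 hx.2).2) (zpow_p_nonneg _)

end Block

/-! ### §4 The shifted vector: its level-`m` classes are unhit level-`m` classes of `b` with the same pair vectors -/

section Shifted

variable (b : ℕ → ℤ) (hb : InPolytope b) {j : ℕ} (hj1 : 1 ≤ j) (hj7 : j ≤ 7) (hb' : InPolytope (shift b j))
  (hpN : p ≤ (b 0).toNat) {m : ℤ} (hmin : ∀ x, x < p → m ≤ classExp b p x)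
  (hcen : ∀ x, x < p → classExp b p x = m → ¬ CentreIn b p x)

omit hp in
include hj1 in
/-- `conjClass` does not see the shift. -/
theorem conjClass_shift (x : ℕ) : conjClass (shift b j) p x = conjClass b p x := by
  unfold conjClass; rw [shift_zero b hj1]

include hb hj1 hj7 hb' hmin in
omit hp in
/-- A level-`m` class of `b + e_j` is a level-`m` class of `b`, and it is unhit. -/
theorem minSet_shift_sub {x : ℕ} (hx : x ∈ (Finset.filter (fun x => classExp (shift b j) p x = m) (Finset.range p))) :
    x ∈ (Finset.filter (fun x => classExp b p x = m) (Finset.range p)) ∧ (b j).toNat ∉ classSet b p x ∧ (b 0).toNat - (b j).toNat ∉ classSet b p x := by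
  obtain ⟨hxp, hE⟩ := mem_minSet.1 hx
  have h1 := classExp_shift_ge b hb.1 hj1 p x
  have h2 := hmin x hxp
  have hEb : classExp b p x = m := le_antisymm (by omega) h2
  exact ⟨mem_minSet.2 ⟨hxp, hEb⟩, unhit_of_classExp_eq b hb hj1 hj7 hb' (by rw [hE, hEb])⟩

include hb hj1 hj7 hb' hpN hmin hcen in
/-- **The digits `ŵ`, `v̂` of an unhit level-`m` class are the same for `b + e_j`.** -/
theorem hat_shift_eq {x : ℕ} (hx : x ∈ (Finset.filter (fun x => classExp (shift b j) p x = m) (Finset.range p))) :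
    wHat (shift b j) p x = wHat b p x ∧ vHat (shift b j) p x = vHat b p x := by
  obtain ⟨hxb, hu1, hu2⟩ := minSet_shift_sub b hb hj1 hj7 hb' hmin hx
  obtain ⟨hxp, hE⟩ := mem_minSet.1 hxb
  obtain ⟨hL, hL'⟩ := level_of_lt b hxp hpN
  set L := ((b 0).toNat - x) / p with hLdef
  have hN' : ((shift b j) 0).toNat = (b 0).toNat := by rw [shift_zero b hj1]
  have hLs : x + L * p ≤ ((shift b j) 0).toNat := by rw [hN']; exact hL
  have hLs' : ((shift b j) 0).toNat < x + L * p + p := by rw [hN']; exact hL'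
  set e : ℕ → ℤ := fun k => netExp b (x + k * p) with hedef
  have he : ∀ k ≤ L, netExp b (x + k * p) = e k := fun k _ => rfl
  have he' : ∀ k ≤ L, netExp (shift b j) (x + k * p) = e k := fun k hk =>
    netExp_shift_of_unhit b hb hj1 hj7 hb' hu1 hu2 (level_mem b hxp hL hL' hk)
  have hc : ¬ CentreIn b p x := hcen x hxp hE
  have hc' : ¬ CentreIn (shift b j) p x := fun h => hc ((centreIn_shift b hj1 p x).1 h)
  rw [wHat_level (shift b j) hxp hLs hLs' e he' hc', vHat_level (shift b j) hxp hLs hLs' e he' hc',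
    wHat_level b hxp hL hL' e he hc, vHat_level b hxp hL hL' e he hc]
  exact ⟨rfl, rfl⟩

include hb hj1 hj7 hb' hpN hmin hcen in
/-- **The pair vectors of the level-`m` classes of `b + e_j` are those of `b`.** -/
theorem pair_shift_eq {x : ℕ} (hx : x ∈ (Finset.filter (fun x => classExp (shift b j) p x = m) (Finset.range p))) :
    (wHat (shift b j) p x + (-1 : ℚ) ^ (m + 1) * wHat (shift b j) p (conjClass (shift b j) p x)) = (wHat b p x + (-1 : ℚ) ^ (m + 1) * wHat b p (conjClass b p x)) ∧ (vHat (shift b j) p x + (-1 : ℚ) ^ (m + 1) * vHat (shift b j) p (conjClass (shift b j) p x)) = (vHat b p x + (-1 : ℚ) ^ (m + 1) * vHat b p (conjClass b p x)) := by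
  have h0' : 0 ≤ (shift b j) 0 := hb'.1.1
  have hpN' : p ≤ ((shift b j) 0).toNat := by rw [shift_zero b hj1]; exact hpN
  have hx' : conjClass (shift b j) p x ∈ (Finset.filter (fun x => classExp (shift b j) p x = m) (Finset.range p)) := conj_mem_minSet (shift b j) hpN' h0' hx
  obtain ⟨w1, v1⟩ := hat_shift_eq b hb hj1 hj7 hb' hpN hmin hcen hx
  obtain ⟨w2, v2⟩ := hat_shift_eq b hb hj1 hj7 hb' hpN hmin hcen hx'
  rw [conjClass_shift b hj1] at w2 v2
  rw [conjClass_shift b hj1, w1, v1, w2, v2]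
  exact ⟨rfl, rfl⟩

end Shifted

end Summit.KontsevichZagierPeriods.Zeta5Search.CellKit

end
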